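import Literature.IUT.HodgeTheaters.InitialThetaDataTorsionProofs
import Literature.NumberTheory.EllipticCurves.MultiplicativeReductionBaseChangeTorsionProofs
import HarnessLib

/-!
# [IUTchI] Example 3.2 (iv), valuation half, AT AN INITIAL Θ-DATUM: `2l ∣ ord_{v̲}(q_{v̲})` — proofs

`Proofs` companion (theorems only; no definitions, no named facts, no instances) of
`Literature.IUT.HodgeTheaters.InitialThetaData` (abc-iut-L5-t2). S. Mochizuki, *Inter-universal
Teichmüller theory I*, kurims May-2020 manuscript, Example 3.2 (iv) p. 71: "Write `q_v̲` for the
`q`-parameter of the elliptic curve `E_v̲` over `K_v̲`. … it follows from our assumption concerning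
`2`-torsion [cf. Definition 3.1, (b)], together with the definition of “`K`” [cf. Definition 3.1,
(c)], that `q_v̲` admits a `2l`-th root in `𝒪^▷(T_{X̲̲_v̲}) (≅ 𝒪^▷_{K_v̲})`."
[claim: Mochizuki2012, status: disputed] — here the VALUATION consequence of that sentence,
`2l ∣ ord_{v̲}(q_{v̲}) = ord_{v̲}(Δ_min(E_K))`, is PROVED for every inhabitant
`D : InitialThetaData F K Fbar E l P` of the typing and every finite place `v̲` of `K` lying over
`𝕍^bad_mod`, with NO further hypothesis:

* `InitialThetaData.natCast_mem_iff_residueChar_dvd` — for a finite place `w` of `K` and `n : ℕ`,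
  `n ∈ 𝔭_w ↔ p ∣ n` where `p` is the residue characteristic (§0 p. 36, `residueChar`) of the place of
  `F_mod` below `w` (the residue field extensions `κ(w_mod) ⊆ κ(w_F) ⊆ κ(w)` preserve the characteristic);
* `InitialThetaData.two_notMem_of_over_VbadMod`, `…l_notMem_of_over_VbadMod` — at a place of `K` over
  `𝕍^bad_mod`: `2 ∉ 𝔭_{v̲}` (Def. 3.1 (b) "of odd residue characteristic", field `VbadMod_odd`) and
  `l ∉ 𝔭_{v̲}` (Def. 3.1 (c) "`l` is prime to the elements of `𝕍^bad_mod`", field `l_ne_residueChar`);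
* `InitialThetaData.hasMultiplicativeReductionAt_under_of_over_VbadMod` — `E_F` has multiplicative
  reduction at the place of `F` below `v̲` (Def. 3.1 (b), field `multiplicative_over_VbadMod`);
* **`InitialThetaData.two_mul_l_dvd_ordMinimalDiscriminant`** — `2l ∣ ord_{v̲}(Δ_min(E_K))` at every
  finite place `v̲` of `K` over `𝕍^bad_mod`: the classical theorem
  `WeierstrassCurve.two_mul_dvd_ordMinimalDiscriminant_baseChange_of_forall_smul_geomTorsion_eq`
  (`MultiplicativeReductionBaseChangeTorsionProofs.lean`: Silverman *AEC* VII.5.1/VII.6.1, *ATAEC*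
  V.6.1) fed with the four items above and with the Galois inputs `Γ_K` fixes `E_K[2]`, `E_K[l]`
  (`InitialThetaDataTorsionProofs.lean`: `smul_geomTorsion_two_eq`, `smul_geomTorsion_l_eq`).

NOT here (named, classical, local): the `2l`-th ROOT itself (unit part of `q_{v̲}`; Tate
uniformisation `E_K ×_K K_{v̲} ≅ E_q` and `Γ_{K_{v̲}} ↪ Γ_K`). Nothing here takes a side on
[IUTchIII] Cor. 3.12; this is a kernel check of one printed inference about the initial Θ-data.
Axioms: `propext`, `Classical.choice`, `Quot.sound`.

## References

* [Mochizuki2012] S. Mochizuki, IUT I, §0 p. 36, Def. 3.1 (b)(c) pp. 61–62, Example 3.2 (iv) p. 71.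
* [SilvermanAEC2009] J. H. Silverman, *The Arithmetic of Elliptic Curves*, 2nd ed., VII.5.1, VII.6.1.
* [SilvermanATAEC1994] J. H. Silverman, *Advanced Topics*, GTM 151, V.6 Prop. 6.1.
-/

noncomputable section

open scoped Classical

namespace Literature.IUT.HodgeTheaters

open WeierstrassCurve NumberField IsDedekindDomain

universe u w

/-! ### Residue characteristics along `F_mod ⊆ F ⊆ K` -/

section ResidueChar

variable {Fm F K : Type u} [Field Fm] [NumberField Fm] [Field F] [NumberField F] [Field K]
  [NumberField K] [Algebra Fm F] [Algebra F K]

/-- The characteristic of a residue ring is that of the residue ring below (the residue map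
`A/p → B/P` of a prime `P` over `p` is injective). [folklore] -/
private theorem ringChar_quotient_eq_of_liesOver {A B : Type*} [CommRing A] [CommRing B] [Algebra A B]
    (P : Ideal B) (p : Ideal A) [P.LiesOver p] : ringChar (A ⧸ p) = ringChar (B ⧸ P) := by
  have hinj : Function.Injective (algebraMap (A ⧸ p) (B ⧸ P)) := FaithfulSMul.algebraMap_injective _ _
  haveI : CharP (B ⧸ P) (ringChar (B ⧸ P)) := ringChar.charP _
  haveI := (RingHom.charP_iff _ hinj (ringChar (B ⧸ P))).mpr this
  exact ringChar.eq _ (ringChar (B ⧸ P))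

omit [NumberField F] [NumberField K] in
/-- **`n ∈ 𝔭_w ↔ p_{w_mod} ∣ n`**: for a finite place `w` of `K ⊇ F ⊇ F_m` and `n : ℕ`, `n` lies in
the prime of `w` iff the residue characteristic (IUTchI §0 p. 36, `residueChar`) of the place of `F_m`
below `w` divides `n` (the residue field extensions preserve the characteristic).
[cite: Mochizuki2012, §0 p.36] -/
theorem InitialThetaData.natCast_mem_iff_residueChar_dvd (w : HeightOneSpectrum (𝓞 K)) (n : ℕ) :
    (n : 𝓞 K) ∈ w.asIdeal ↔ residueChar (FinitePlace.mk ((w.under (𝓞 F)).under (𝓞 Fm))) ∣ n := by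
  haveI h1 : w.asIdeal.LiesOver (w.under (𝓞 F)).asIdeal := ⟨rfl⟩
  haveI h2 : (w.under (𝓞 F)).asIdeal.LiesOver ((w.under (𝓞 F)).under (𝓞 Fm)).asIdeal := ⟨rfl⟩
  unfold residueChar
  rw [FinitePlace.maximalIdeal_mk,
    ringChar_quotient_eq_of_liesOver (w.under (𝓞 F)).asIdeal ((w.under (𝓞 F)).under (𝓞 Fm)).asIdeal,
    ringChar_quotient_eq_of_liesOver w.asIdeal (w.under (𝓞 F)).asIdeal, ← ringChar.spec,
    ← map_natCast (Ideal.Quotient.mk w.asIdeal), Ideal.Quotient.eq_zero_iff_mem]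

end ResidueChar

/-! ### At an initial Θ-datum -/

section InitialThetaData

variable {F K : Type u} {Fbar : Type w} [Field F] [NumberField F] [Field K] [NumberField K]
  [Algebra F K] [Field Fbar] [Algebra F Fbar] [Algebra K Fbar] {E : WeierstrassCurve F} [E.IsElliptic]
  {l : ℕ} {P : BadPlacePredicates K} (D : InitialThetaData F K Fbar E l P)

namespace InitialThetaData

include D

/-- `l ≠ 2` (Def. 3.1 (c): `l ≥ 5`). [claim: Mochizuki2012, status: disputed] -/
theorem l_ne_two : l ≠ 2 := by
  have h5 := D.five_le_l
  omega

/-- The place of `F_mod` below a finite place `w` of `K` lying over `𝕍^bad_mod` (i.e. with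
`toVMod w ∈ 𝕍^bad_mod`) IS the element `FinitePlace.mk ((w ∩ 𝓞_F) ∩ 𝓞_{F_mod})` of `𝕍^bad_mod`
(unfolding of `toVMod = Val.restrict ∘ Val.restrict`). [claim: Mochizuki2012, status: disputed] -/
theorem mk_under_under_mem_VbadMod (w : HeightOneSpectrum (𝓞 K))
    (hw : toVMod F K E (Val.non (FinitePlace.mk w)) ∈ Val.non '' D.VbadMod) :
    FinitePlace.mk ((w.under (𝓞 F)).under (𝓞 (fieldOfModuli E))) ∈ D.VbadMod := by
  obtain ⟨wm, hwm, h⟩ := hw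
  change Val.non wm = Val.non (FinitePlace.mk ((FinitePlace.mk
    ((FinitePlace.mk w).maximalIdeal.under (𝓞 F))).maximalIdeal.under (𝓞 (fieldOfModuli E)))) at h
  rw [FinitePlace.maximalIdeal_mk, FinitePlace.maximalIdeal_mk] at h
  rw [← Sum.inr_injective h]
  exact hwm

/-- **Def. 3.1 (b) "`𝕍^bad_mod` … of odd residue characteristic"** at a place `v̲` of `K` over
`𝕍^bad_mod`: `2 ∉ 𝔭_{v̲}`. [claim: Mochizuki2012, status: disputed] -/
theorem two_notMem_of_over_VbadMod (w : HeightOneSpectrum (𝓞 K))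
    (hw : toVMod F K E (Val.non (FinitePlace.mk w)) ∈ Val.non '' D.VbadMod) : (2 : 𝓞 K) ∉ w.asIdeal := by
  intro h
  have h' : ((2 : ℕ) : 𝓞 K) ∈ w.asIdeal := by exact_mod_cast h
  rw [natCast_mem_iff_residueChar_dvd (Fm := fieldOfModuli E) (F := F) w 2] at h'
  have hmem := D.mk_under_under_mem_VbadMod w hw
  have hodd := D.VbadMod_odd _ hmem
  have hne1 : residueChar (FinitePlace.mk ((w.under (𝓞 F)).under (𝓞 (fieldOfModuli E)))) ≠ 1 := by
    unfold residueChar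
    haveI := Ideal.Quotient.nontrivial_iff.mpr
      (FinitePlace.mk ((w.under (𝓞 F)).under (𝓞 (fieldOfModuli E)))).maximalIdeal.isPrime.ne_top
    exact CharP.ringChar_ne_one
  rcases (Nat.dvd_prime Nat.prime_two).1 h' with h1 | h2
  · exact hne1 h1
  · rw [h2] at hodd
    exact (Nat.not_odd_iff_even.2 (by decide)) hodd

/-- **Def. 3.1 (c) "`l` is prime to the elements of `𝕍^bad_mod`"** at a place `v̲` of `K` over
`𝕍^bad_mod`: `l ∉ 𝔭_{v̲}`. [claim: Mochizuki2012, status: disputed] -/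
theorem l_notMem_of_over_VbadMod (w : HeightOneSpectrum (𝓞 K))
    (hw : toVMod F K E (Val.non (FinitePlace.mk w)) ∈ Val.non '' D.VbadMod) : (l : 𝓞 K) ∉ w.asIdeal := by
  intro h
  rw [natCast_mem_iff_residueChar_dvd (Fm := fieldOfModuli E) (F := F) w l] at h
  have hmem := D.mk_under_under_mem_VbadMod w hw
  have hne1 : residueChar (FinitePlace.mk ((w.under (𝓞 F)).under (𝓞 (fieldOfModuli E)))) ≠ 1 := by
    unfold residueChar
    haveI := Ideal.Quotient.nontrivial_iff.mpr
      (FinitePlace.mk ((w.under (𝓞 F)).under (𝓞 (fieldOfModuli E)))).maximalIdeal.isPrime.ne_top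
    exact CharP.ringChar_ne_one
  rcases (Nat.dvd_prime D.l_prime).1 h with h1 | h2
  · exact hne1 h1
  · exact D.l_ne_residueChar _ hmem h2

/-- **Def. 3.1 (b) "`X_F` has bad [i.e., multiplicative] reduction at the elements of `𝕍(F)` that lie
over `𝕍^bad_mod`"** at the place `v̲ ∩ 𝓞_F` of `F` below a place `v̲` of `K` over `𝕍^bad_mod`.
[claim: Mochizuki2012, status: disputed] -/
theorem hasMultiplicativeReductionAt_under_of_over_VbadMod (w : HeightOneSpectrum (𝓞 K))
    (hw : toVMod F K E (Val.non (FinitePlace.mk w)) ∈ Val.non '' D.VbadMod) :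
    E.HasMultiplicativeReductionAt (w.under (𝓞 F)) := by
  have hw' : Val.restrict (fieldOfModuli E) (Val.non (FinitePlace.mk (w.under (𝓞 F)))) ∈
      Val.non '' D.VbadMod := by
    have h : toVMod F K E (Val.non (FinitePlace.mk w)) =
        Val.restrict (fieldOfModuli E) (Val.non (FinitePlace.mk (w.under (𝓞 F)))) := by
      change Val.restrict (fieldOfModuli E)
        (Val.non (FinitePlace.mk ((FinitePlace.mk w).maximalIdeal.under (𝓞 F)))) = _
      rw [FinitePlace.maximalIdeal_mk]
    rwa [h] at hw
  have hm := D.multiplicative_over_VbadMod (FinitePlace.mk (w.under (𝓞 F))) hw'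
  rwa [FinitePlace.maximalIdeal_mk] at hm

/-- **[IUTchI] Example 3.2 (iv), valuation half, PROVED at the initial Θ-datum**: for every finite
place `v̲` of `K` lying over `𝕍^bad_mod`, `2l ∣ ord_{v̲}(Δ_min(E_K)) (= ord_{v̲}(q_{v̲}))` — from Def. 3.1
(b) (multiplicative reduction over `𝕍^bad_mod`, odd residue characteristic, `2·3`-torsion rational
over `F`) and (c) (`l ≥ 5` prime, prime to `𝕍^bad_mod`, `K = F(E_F[l])`) through the classical
theorem `two_mul_dvd_ordMinimalDiscriminant_baseChange_of_forall_smul_geomTorsion_eq` (Silverman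
*AEC* VII.5.1, VII.6.1; *ATAEC* V.6.1) and `Γ_K` fixing `E_K[2]`, `E_K[l]` (`InitialThetaDataTorsionProofs`).
The `2l`-th ROOT of `q_{v̲}` in `K_{v̲}` (the unit part; Tate uniformisation) is not claimed here.
[claim: Mochizuki2012, status: disputed] -/
theorem two_mul_l_dvd_ordMinimalDiscriminant (w : HeightOneSpectrum (𝓞 K))
    (hw : toVMod F K E (Val.non (FinitePlace.mk w)) ∈ Val.non '' D.VbadMod) :
    2 * l ∣ (E.baseChange K).ordMinimalDiscriminant w := by
  haveI : w.asIdeal.LiesOver (w.under (𝓞 F)).asIdeal := ⟨rfl⟩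
  exact E.two_mul_dvd_ordMinimalDiscriminant_baseChange_of_forall_smul_geomTorsion_eq
    (D.hasMultiplicativeReductionAt_under_of_over_VbadMod w hw) D.l_prime D.l_ne_two
    (D.two_notMem_of_over_VbadMod w hw) (D.l_notMem_of_over_VbadMod w hw)
    D.smul_geomTorsion_two_eq D.smul_geomTorsion_l_eq

end InitialThetaData

end InitialThetaData

end Literature.IUT.HodgeTheaters

end
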